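import Mathlib
import Literature.AlgebraicGeometry.Resolution.CobordantGame
import Summits.ResolutionOfSingularities.ResolutionOfSingularities.Theorems.WeightedInvariantLocalWeightedDropInsepCleaning
import Summits.ResolutionOfSingularities.ResolutionOfSingularities.Theorems.WeightedInvariantLocalWeightedDropMonicRecentre
import Summits.ResolutionOfSingularities.ResolutionOfSingularities.Theorems.WeightedInvariantLocalWeightedDropTerminalDoublePointsAux

/-!
# `WeightedInvariant.LocalWeightedDrop`, line `hasse-ridge-face-selection`: ARTIN–SCHREIER CLEANING of a pure separable char-`2`
# double point `y² + x^α · y + A₀` — the normal form «no square monomial `x^{2e}` with `¬ (α ≤ e)`»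

Crux item stmt-ResolutionOfSingularities-8899 `LocalWeightedDrop` (route `ResolutionOfSingularities/WeightedInvariant`), serving the
door `HypersurfaceCentreConstruction` stmt-ResolutionOfSingularities-19897.  [OURS · L1 W4.3, chain w43, stub worker 5 (seat res-D-pv-056):
brick U0 of the S2sP work order (`L/res-L1-w43-stub-2/S2sP-WORK-ORDER.md` §4/§5) for the registered stub S2sP `stub_charTwoSeparablePureWon`
of skeleton v28; NOT a statement of any manuscript.]

A re-centring `y ↦ y + φ(x)` of the pure separable position `y² + x^α y + A₀` (characteristic `2`) replaces `A₀` by `A₀ + x^α φ + φ²`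
(`won_monic_two_recentre_iff`, p469560): the position is the class of `A₀` modulo the additive subgroup `N_α = {φ² + x^α φ}` — the
separable analogue of «`A₀` modulo squares» of the purely inseparable piece (`InsepCleaning`, p482405).  This file proves the
NORMAL FORM: over an algebraically closed field of characteristic `2`, every `A₀` is re-centred (by a `φ` with NO monomial `x^e`, `α ≤ e`,
and no monomial of degree `< ord A₀ / 2`) to a series with NO SQUARE MONOMIAL `x^{2e}` in the region `¬ (α ≤ e)` — the monomials
`x^{2e}` with `α ≤ e` are multiples of `x^{2α} = (x^α)²` and belong to the terminal «monomial» part (`stub_charTwoSeparableTerminalWon`,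
case (M2)).  Since a sum of non-square monomials is never a square in characteristic `2`, the normal form is simultaneously
`ω`-clean for EVERY weight `ω` («`2ω(x^α) ≤ ω(A₀)` or `in_ω(A₀)` is not a square», Hauser–Perlega 2024 Remark after Prop. 5 /
Perlega 2017 §7.2 at `c = 2`), which is what the flag invariant of the S2sP engine consumes.

Construction (finite!): one GENERATION adds `ψ =` the square root of the even part of `A` in the region; the only square monomials it
re-creates come from `x^α ψ`, at exponents `2e` with FEED `2e − α`, and the feed map `e ↦ 2e − α` strictly lowers every deficient
coordinate (`e_i < α_i ⇒ (2e − α)_i < e_i`); so after `N` generations no square monomial `x^{2e}` with a deficient coordinate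
`e_i < min(α_i, N)` survives (`coeff_two_nsmul_gen`, `gen_succ`), and `N = degree α` generations clean the whole region.

* `exists_genRoot` — a generation root `ψ` (`([x^e]ψ)² = [x^{2e}]A` on the region, `0` off it);
* `coeff_two_nsmul_gen` — `[x^{2e}](A + x^α ψ + ψ²) = [x^{2e−α}] ψ` (if `α ≤ 2e`, else `0`) for `e` in the region;
* `coeff_gen_eq_zero_of_degree_lt` — a generation keeps `ord ≥ m` whenever `m ≤ 2·deg α`;
* `exists_asClean` — THE NORMAL FORM (any index type `σ`);
* `exists_asClean_pure` / `won_pure_of_won_asClean` — the game form on `k[[x₀,x₁]]` with `x^α = x₀^a x₁^b`, `a + b ≥ 2`, `ord A₀ ≥ 3`: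
  a constant-free `φ` keeping `ord ≥ 3`, and «to win the position it suffices to win its clean representative».
AI-written; gate-accepted means sorry-free with standard axioms, not refereed.
-/

set_option linter.dupNamespace false -- mandated namespace of this single-conjunct summit

namespace Summit.ResolutionOfSingularities.ResolutionOfSingularities.Theorems

open Literature.AlgebraicGeometry.Resolution
open Literature.AlgebraicGeometry.Resolution.CobordantGame

namespace SepPureCleaning

open MvPowerSeries InsepCleaning

variable {k : Type} [Field k] {σ : Type}

/-! ### One cleaning generation -/

/-- In characteristic `2`: `2 φ = 0` in `k[[x]]`. -/
theorem two_mul_eq_zero [CharP k 2] (φ : MvPowerSeries σ k) : 2 * φ = 0 := by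
  ext d
  rw [two_mul, map_add, map_zero, CharTwo.add_self_eq_zero]

/-- A GENERATION ROOT for `(α, A)` over an algebraically closed field: `ψ` vanishes off the region `¬ (α ≤ e)` and on it
`([x^e] ψ)² = [x^{2e}] A` (the square root of the even part of `A` in the region). -/
theorem exists_genRoot [IsAlgClosed k] (α : σ →₀ ℕ) (A : MvPowerSeries σ k) :
    ∃ ψ : MvPowerSeries σ k, (∀ e, α ≤ e → coeff e ψ = 0) ∧ (∀ e, ¬ α ≤ e → coeff e ψ ^ 2 = coeff (2 • e) A) := by
  classical
  obtain ⟨φ, hφ⟩ := exists_sq_coeff_eq A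
  refine ⟨fun e => if α ≤ e then 0 else coeff e φ, fun e he => ?_, fun e he => ?_⟩
  · show (if α ≤ e then 0 else coeff e φ) = 0
    rw [if_pos he]
  · show (if α ≤ e then 0 else coeff e φ) ^ 2 = _
    rw [if_neg he, hφ]

/-- COEFFICIENTS OF ONE GENERATION on the region (characteristic `2`): for `¬ (α ≤ e)`,
`[x^{2e}](A + x^α ψ + ψ²) = [x^{2e − α}] ψ` if `α ≤ 2e` and `0` otherwise — the old square monomial is killed by `ψ²` and the only
new contribution is the feed from `x^α ψ`. -/
theorem coeff_two_nsmul_gen [CharP k 2] {α : σ →₀ ℕ} {A ψ : MvPowerSeries σ k}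
    (hψ : ∀ e, ¬ α ≤ e → coeff e ψ ^ 2 = coeff (2 • e) A) {e : σ →₀ ℕ} (he : ¬ α ≤ e) :
    coeff (2 • e) (A + monomial α 1 * ψ + ψ ^ 2) = if α ≤ 2 • e then coeff (2 • e - α) ψ else 0 := by
  classical
  rw [map_add, map_add, coeff_two_nsmul_sq, hψ e he, coeff_monomial_mul, add_comm (coeff (2 • e) A), add_assoc,
    CharTwo.add_self_eq_zero, add_zero]
  split_ifs
  · rw [one_mul]
  · rfl

/-- OFF THE EVEN LATTICE a generation only adds the feed: `[x^d](A + x^α ψ + ψ²) = [x^d] A + [x^{d−α}] ψ` (if `α ≤ d`) for `d` not of the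
form `2e`. -/
theorem coeff_gen_of_not_even [CharP k 2] {α : σ →₀ ℕ} (A ψ : MvPowerSeries σ k) {d : σ →₀ ℕ} (hd : ¬ ∀ i, 2 ∣ d i) :
    coeff d (A + monomial α 1 * ψ + ψ ^ 2) = coeff d A + if α ≤ d then coeff (d - α) ψ else 0 := by
  classical
  rw [map_add, map_add, coeff_sq_eq_zero_of_not_even ψ hd, add_zero, coeff_monomial_mul]
  split_ifs
  · rw [one_mul]
  · rfl

/-- A generation root has NO monomial of degree `< m/2` when `A` has order `≥ m` (`([x^e]ψ)² = [x^{2e}]A = 0`). -/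
theorem coeff_genRoot_eq_zero_of_degree_lt {α : σ →₀ ℕ} {A ψ : MvPowerSeries σ k}
    (hψ0 : ∀ e, α ≤ e → coeff e ψ = 0) (hψ : ∀ e, ¬ α ≤ e → coeff e ψ ^ 2 = coeff (2 • e) A)
    {m : ℕ} (hA : ∀ d : σ →₀ ℕ, d.degree < m → coeff d A = 0) {e : σ →₀ ℕ} (he : 2 * e.degree < m) :
    coeff e ψ = 0 := by
  by_cases hαe : α ≤ e
  · exact hψ0 e hαe
  · have h := hψ e hαe
    rw [hA (2 • e) (by rwa [map_nsmul, smul_eq_mul]), sq_eq_zero_iff] at h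
    exact h

/-- ORDER IS KEPT by a generation: if `A` has order `≥ m` and `m ≤ 2·deg α`, then so has `A + x^α ψ + ψ²`
(`ψ²` only deletes monomials; `x^α ψ` has order `≥ deg α + m/2 ≥ m`). -/
theorem coeff_gen_eq_zero_of_degree_lt [CharP k 2] {α : σ →₀ ℕ} {A ψ : MvPowerSeries σ k}
    (hψ0 : ∀ e, α ≤ e → coeff e ψ = 0) (hψ : ∀ e, ¬ α ≤ e → coeff e ψ ^ 2 = coeff (2 • e) A)
    {m : ℕ} (hm : m ≤ 2 * α.degree) (hA : ∀ d : σ →₀ ℕ, d.degree < m → coeff d A = 0)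
    {d : σ →₀ ℕ} (hd : d.degree < m) :
    coeff d (A + monomial α 1 * ψ + ψ ^ 2) = 0 := by
  classical
  -- the feed term vanishes in degree `< m`
  have hfeed : (if α ≤ d then coeff (d - α) ψ else 0) = 0 := by
    split_ifs with hαd
    · refine coeff_genRoot_eq_zero_of_degree_lt hψ0 hψ hA ?_
      have hdeg : (d - α).degree + α.degree = d.degree := by
        rw [← map_add, tsub_add_cancel_of_le hαd]
      omega
    · rfl
  by_cases hev : ∀ i, 2 ∣ d i
  · obtain ⟨e, rfl⟩ := exists_eq_two_nsmul_of_even hev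
    by_cases hαe : α ≤ e
    · -- on `α ≤ e` the root vanishes at `e` and at `2e - α` (`α ≤ 2e - α`)
      rw [map_add, map_add, coeff_two_nsmul_sq, hψ0 e hαe, coeff_monomial_mul, hA _ hd]
      have h2 : α ≤ 2 • e - α := by
        refine Finsupp.le_def.mpr fun i => ?_
        have := Finsupp.le_def.mp hαe i
        simp only [Finsupp.tsub_apply, Finsupp.smul_apply, smul_eq_mul]
        omega
      rw [hψ0 _ h2]
      simp
    · rw [coeff_two_nsmul_gen hψ hαe]
      exact hfeed
  · rw [coeff_gen_of_not_even A ψ hev, hA d hd, hfeed, add_zero]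

/-! ### The chain bound: `N` generations clean every `x^{2e}` with a deficient coordinate `e_i < min (α_i, N)` -/

/-- INDUCTION STEP.  If `A` has no square monomial `x^{2e}` with a deficient coordinate `e_i < α_i`, `e_i < n`, then after one generation
there is none with `e_i < α_i`, `e_i < n + 1`: the feed of `x^{2e}` is `[x^{2e−α}]ψ`, whose square is `[x^{2(2e−α)}]A`, and
`(2e − α)_i = 2e_i − α_i < e_i ≤ n` is again deficient. -/
theorem gen_succ [CharP k 2] {α : σ →₀ ℕ} {A ψ : MvPowerSeries σ k}
    (hψ0 : ∀ e, α ≤ e → coeff e ψ = 0) (hψ : ∀ e, ¬ α ≤ e → coeff e ψ ^ 2 = coeff (2 • e) A) {n : ℕ}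
    (hP : ∀ (e : σ →₀ ℕ) (i : σ), e i < α i → e i < n → coeff (2 • e) A = 0) :
    ∀ (e : σ →₀ ℕ) (i : σ), e i < α i → e i < n + 1 → coeff (2 • e) (A + monomial α 1 * ψ + ψ ^ 2) = 0 := by
  intro e i hi hn
  have he : ¬ α ≤ e := fun h => absurd (Finsupp.le_def.mp h i) (not_le.mpr hi)
  rw [coeff_two_nsmul_gen hψ he]
  split_ifs with h2
  · by_cases h3 : α ≤ 2 • e - α
    · exact hψ0 _ h3
    · have hsq := hψ _ h3
      have h2i : α i ≤ 2 * e i := by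
        have := Finsupp.le_def.mp h2 i
        simpa only [Finsupp.smul_apply, smul_eq_mul] using this
      have hlt₁ : (2 • e - α) i < α i := by
        simp only [Finsupp.tsub_apply, Finsupp.smul_apply, smul_eq_mul]
        omega
      have hlt₂ : (2 • e - α) i < n := by
        simp only [Finsupp.tsub_apply, Finsupp.smul_apply, smul_eq_mul]
        omega
      rw [hP _ i hlt₁ hlt₂, sq_eq_zero_iff] at hsq
      exact hsq
  · rfl

/-- THE ITERATION: after `n` generations — accumulated into ONE re-centring `φ` (characteristic `2`: `(φ + ψ)² = φ² + ψ²`) — the series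
`A + x^α φ + φ²` has no square monomial `x^{2e}` with a deficient coordinate `e_i < α_i`, `e_i < n`; `φ` has no monomial `x^e` with
`α ≤ e` and none of degree `< m/2`; the order `≥ m` is kept (`m ≤ 2·deg α`). -/
theorem exists_asClean_upTo [CharP k 2] [IsAlgClosed k] (α : σ →₀ ℕ) {m : ℕ} (hm : m ≤ 2 * α.degree)
    (A : MvPowerSeries σ k) (hA : ∀ d : σ →₀ ℕ, d.degree < m → coeff d A = 0) (n : ℕ) :
    ∃ φ : MvPowerSeries σ k, (∀ e, α ≤ e → coeff e φ = 0) ∧ (∀ e : σ →₀ ℕ, 2 * e.degree < m → coeff e φ = 0) ∧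
      (∀ d : σ →₀ ℕ, d.degree < m → coeff d (A + monomial α 1 * φ + φ ^ 2) = 0) ∧
      ∀ (e : σ →₀ ℕ) (i : σ), e i < α i → e i < n → coeff (2 • e) (A + monomial α 1 * φ + φ ^ 2) = 0 := by
  classical
  induction n with
  | zero =>
    refine ⟨0, fun _ _ => map_zero _, fun _ _ => map_zero _, ?_, fun e i _ h => absurd h (Nat.not_lt_zero _)⟩
    simpa only [mul_zero, add_zero, zero_pow two_ne_zero] using hA
  | succ n ih =>
    obtain ⟨φ, hφ0, hφm, hAm, hP⟩ := ih
    obtain ⟨ψ, hψ0, hψ⟩ := exists_genRoot α (A + monomial α 1 * φ + φ ^ 2)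
    have hsq : (φ + ψ) ^ 2 = φ ^ 2 + ψ ^ 2 := by
      rw [add_sq, two_mul_eq_zero, zero_mul, add_zero]
    have hstep : A + monomial α 1 * (φ + ψ) + (φ + ψ) ^ 2 =
        (A + monomial α 1 * φ + φ ^ 2) + monomial α 1 * ψ + ψ ^ 2 := by
      rw [hsq]; ring
    refine ⟨φ + ψ, fun e he => ?_, fun e he => ?_, fun d hd => ?_, fun e i hi hn => ?_⟩
    · rw [map_add, hφ0 e he, hψ0 e he, add_zero]
    · rw [map_add, hφm e he, coeff_genRoot_eq_zero_of_degree_lt hψ0 hψ hAm he, add_zero]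
    · rw [hstep]
      exact coeff_gen_eq_zero_of_degree_lt hψ0 hψ hm hAm hd
    · rw [hstep]
      exact gen_succ hψ0 hψ hP e i hi hn

/-- THE ARTIN–SCHREIER NORMAL FORM (characteristic `2`, `k` algebraically closed, any set of variables).  For every exponent `α` and
every series `A` of order `≥ m` with `m ≤ 2·deg α` there is a re-centring `φ` — with NO monomial `x^e`, `α ≤ e`, and none of degree
`< m/2` — such that `A + x^α φ + φ²` has order `≥ m` and NO SQUARE MONOMIAL `x^{2e}` with `¬ (α ≤ e)`. -/
theorem exists_asClean [CharP k 2] [IsAlgClosed k] (α : σ →₀ ℕ) {m : ℕ} (hm : m ≤ 2 * α.degree)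
    (A : MvPowerSeries σ k) (hA : ∀ d : σ →₀ ℕ, d.degree < m → coeff d A = 0) :
    ∃ φ : MvPowerSeries σ k, (∀ e, α ≤ e → coeff e φ = 0) ∧ (∀ e : σ →₀ ℕ, 2 * e.degree < m → coeff e φ = 0) ∧
      (∀ d : σ →₀ ℕ, d.degree < m → coeff d (A + monomial α 1 * φ + φ ^ 2) = 0) ∧
      ∀ e : σ →₀ ℕ, ¬ α ≤ e → coeff (2 • e) (A + monomial α 1 * φ + φ ^ 2) = 0 := by
  obtain ⟨φ, hφ0, hφm, hAm, hP⟩ := exists_asClean_upTo α hm A hA α.degree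
  refine ⟨φ, hφ0, hφm, hAm, fun e he => ?_⟩
  obtain ⟨i, hi⟩ : ∃ i, e i < α i := by
    by_contra h
    push Not at h
    exact he (Finsupp.le_def.mpr h)
  exact hP e i hi (lt_of_lt_of_le hi (Finsupp.le_degree i α))

/-! ### The game form on `k[[x₀,x₁]]`: pure separable positions `y² + x₀^a x₁^b · y + A₀` -/

/-- `ord A > 2` as a coefficient condition. -/
theorem coeff_eq_zero_of_degree_lt_three {A : MvPowerSeries (Fin 2) k} (hA : (2 : ℕ∞) < A.order)
    (d : Fin 2 →₀ ℕ) (hd : d.degree < 3) : coeff d A = 0 := by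
  refine coeff_of_lt_order (lt_of_le_of_lt ?_ hA)
  exact_mod_cast Nat.lt_succ_iff.mp hd

/-- THE NORMAL FORM OF A PURE SEPARABLE POSITION (`k = k̄`, characteristic `2`): for `a + b ≥ 2` and `ord A₀ ≥ 3` there is a
constant-free re-centring `φ` (indeed `ord φ ≥ 2`, and `φ` has no monomial `x^e` with `e ≥ (a,b)`) such that `A₀ + x₀^a x₁^b φ + φ²`
has order `≥ 3` and NO SQUARE MONOMIAL `x₀^{2e₀} x₁^{2e₁}` with `e₀ < a` or `e₁ < b`. -/
theorem exists_asClean_pure [CharP k 2] [IsAlgClosed k] (a b : ℕ) (hab : 2 ≤ a + b)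
    (A₀ : MvPowerSeries (Fin 2) k) (hA₀ : (2 : ℕ∞) < A₀.order) :
    ∃ φ : MvPowerSeries (Fin 2) k, constantCoeff φ = 0 ∧
      (∀ e : Fin 2 →₀ ℕ, a ≤ e 0 → b ≤ e 1 → coeff e φ = 0) ∧
      (2 : ℕ∞) < (A₀ + X 0 ^ a * X 1 ^ b * φ + φ ^ 2).order ∧
      ∀ e : Fin 2 →₀ ℕ, (e 0 < a ∨ e 1 < b) → coeff (2 • e) (A₀ + X 0 ^ a * X 1 ^ b * φ + φ ^ 2) = 0 := by
  classical
  set α : Fin 2 →₀ ℕ := Finsupp.single 0 a + Finsupp.single 1 b with hα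
  have hα0 : α 0 = a := by simp [hα]
  have hα1 : α 1 = b := by simp [hα]
  have hdeg : α.degree = a + b := by rw [hα, map_add, Finsupp.degree_single, Finsupp.degree_single]
  have hle : ∀ e : Fin 2 →₀ ℕ, α ≤ e ↔ a ≤ e 0 ∧ b ≤ e 1 := fun e => by
    rw [Finsupp.le_def, Fin.forall_fin_two, hα0, hα1]
  obtain ⟨φ, hφ0, hφm, hAm, hP⟩ := exists_asClean (k := k) α (m := 3) (by rw [hdeg]; omega) A₀
    (coeff_eq_zero_of_degree_lt_three hA₀)
  rw [← TerminalDoublePoint.X_pow_mul_X_pow_eq] at hAm hP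
  refine ⟨φ, ?_, fun e h0 h1 => hφ0 e ((hle e).mpr ⟨h0, h1⟩), ?_, fun e he => hP e fun h => ?_⟩
  · have h := hφm 0 (by simp)
    rwa [coeff_zero_eq_constantCoeff_apply] at h
  · refine lt_of_lt_of_le (show (2 : ℕ∞) < ((3 : ℕ) : ℕ∞) by exact_mod_cast (by norm_num)) (le_order fun d hd => hAm d ?_)
    exact_mod_cast hd
  · rw [hle] at h
    omega

/-- GAME COROLLARY — «WLOG ARTIN–SCHREIER CLEAN»: to win the pure separable position `y² + x₀^a x₁^b y + A₀` (`a + b ≥ 2`, `ord A₀ ≥ 3`)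
it suffices to win every CLEAN position `y² + x₀^a x₁^b y + A₀'` (`ord A₀' ≥ 3`, no square monomial `x^{2e}` with `e₀ < a ∨ e₁ < b`) of
the form `A₀' = A₀ + x₀^a x₁^b φ + φ²`, `φ(0) = 0` — by `won_monic_two_recentre_iff` (`2φ = 0`). -/
theorem won_pure_of_won_asClean [CharP k 2] [IsAlgClosed k] (a b : ℕ) (hab : 2 ≤ a + b)
    (A₀ : MvPowerSeries (Fin 2) k) (hA₀ : (2 : ℕ∞) < A₀.order)
    (hW : ∀ φ : MvPowerSeries (Fin 2) k, constantCoeff φ = 0 →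
      (2 : ℕ∞) < (A₀ + X 0 ^ a * X 1 ^ b * φ + φ ^ 2).order →
      (∀ e : Fin 2 →₀ ℕ, (e 0 < a ∨ e 1 < b) → coeff (2 • e) (A₀ + X 0 ^ a * X 1 ^ b * φ + φ ^ 2) = 0) →
      CobordantGame.Won k 3 (X (Fin.last 2) ^ 2 + (rename (Fin.succAboveEmb (Fin.last 2)) (A₀ + X 0 ^ a * X 1 ^ b * φ + φ ^ 2) +
        rename (Fin.succAboveEmb (Fin.last 2)) (X 0 ^ a * X 1 ^ b) * X (Fin.last 2)))) :
    CobordantGame.Won k 3 (X (Fin.last 2) ^ 2 + (rename (Fin.succAboveEmb (Fin.last 2)) A₀ +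
      rename (Fin.succAboveEmb (Fin.last 2)) (X 0 ^ a * X 1 ^ b) * X (Fin.last 2))) := by
  obtain ⟨φ, hφ0, -, hord, hclean⟩ := exists_asClean_pure a b hab A₀ hA₀
  have h := hW φ hφ0 hord hclean
  have h2 : (X 0 ^ a * X 1 ^ b : MvPowerSeries (Fin 2) k) + 2 * φ = X 0 ^ a * X 1 ^ b := by
    rw [two_mul_eq_zero, add_zero]
  have key := won_monic_two_recentre_iff φ hφ0 A₀ (X 0 ^ a * X 1 ^ b)
  rw [h2] at key
  exact key.mp h

end SepPureCleaning

end Summit.ResolutionOfSingularities.ResolutionOfSingularities.Theorems
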